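import Summits.AtomisticToContinuum.HydrodynamicLimit.Theorems.TwoClocksEquilibriumFastWindowLDBirthT12ZonalComm
import Literature.Analysis.UnboundedOperators.LinearizedBoltzmannBddAboveProofs
import Literature.Analysis.UnboundedOperators.LinearizedBoltzmannBoundedImage
import Literature.Analysis.FluidPDE.PineauVicolWeightedIdentity
import HarnessLib

/-!
# The zonal average: linear API, `M`-orthogonality bookkeeping, commutation with `1 - Π₀`
# (helper `t12_zonalAvg_orthogonal_collisionInvariants` (Z4) of the line `birth`, crux
# `TwoClocks.EquilibriumFastWindowLD`, stmt-AtomisticToContinuum-14440; companion of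
# `…T12ZonalComm` — infrastructure file 3 of the analytic residue `t12_logLinearPreimage_and_dipoleModulus`)

Sibling of `TwoClocksEquilibriumFastWindowLDBirthT12ZonalComm` (Z1: the zonal average
`Π₀ψ(v) = (4π)⁻¹∫_{S²} ψ(|v|ω) dσ(ω) = zonalAvg ψ v` commutes with the linearised hard-sphere operator
`L` on measurable functions of Gaussian growth, via the orbit average over `O(3)`). This file adds
the bookkeeping that the sector decomposition of the corrector plan uses around Z1:

* the linear API of `zonalAvg` (`_const_mul`, `_add`, `_sub`), idempotence `Π₀Π₀ = Π₀`
  (`zonalAvg_zonalAvg`), **dipoles have no zonal part** (`zonalAvg_dipole`), the sup bound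
  `|Π₀ψ(v)| ≤ sup_{|u|=|v|}|ψ|` (`abs_zonalAvg_le`) and its Gaussian-growth form, measurability and
  continuity of `Π₀ψ`, integrability of sphere traces, `Π₀(ψ - Π₀ψ) = 0`;
* `L` is subtractive on the Gaussian-growth class (`hardSphereLinearizedOp_sub_of_gaussGrowth`, from
  the tree's `kernelAction_sub_of_gaussGrowth`), hence **`L(ψ - Π₀ψ) = Lψ - Π₀(Lψ)`**
  (`hardSphereLinearizedOp_sub_zonalAvg`): `L` also commutes with the complementary projection;
* **Z4** (`t12_zonalAvg_orthogonal_collisionInvariants`, registered, `zonalAvg` unfolded): if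
  `ψ ⊥_M span{1, v, |v|²}` then `Π₀ψ ⊥_M span{1, v, |v|²}`. Mechanism: `⟪Π₀ψ, ⟪b,·⟫⟫_M = 0` by
  parity (`maxwellianInner_zonalAvg_inner`: `Π₀ψ` is even, the Gaussian is symmetric —
  `integral_stdGaussian_eq_zero_of_odd`), and **`⟪Π₀ψ, φ⟫_M = ⟪ψ, φ⟫_M` for radial `φ` of polynomial
  growth** (`maxwellianInner_zonalAvg_radial`: orbit average `Π₀ψ(v) = ∫_{O(3)} ψ(R⁻¹v) dR`, Fubini in
  `dM dR` — the integrand is dominated by `C D (1+|v|)ᴺ e^{|v|²/4} ∈ L¹(M)`,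
  `integrable_one_add_norm_pow_mul_exp_sq_div_four_stdGaussian` — and invariance of `M` and of `φ`
  under `R⁻¹`, `maxwellianInner_comp_linearIsometryEquiv`).

NOT here: the dipole (`ℓ = 1`) projection and its commutation with `L` (Z2), Funk–Hecke (Z5).
References: Cercignani–Illner–Pulvirenti 1994 §7.3 p. 209 (isotropy); Grad 1963 §4 (sectors).
-/
noncomputable section

open MeasureTheory ProbabilityTheory Real Set Filter Metric TopologicalSpace
open scoped ENNReal BigOperators InnerProductSpace

namespace Summit.AtomisticToContinuum.HydrodynamicLimit.Theorems.ClampedCorrectorBirth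

open Literature.Analysis.FluidPDE Literature.MathematicalPhysics.KineticTheory
open Literature.Analysis.UnboundedOperators

local notation "E3" => EuclideanSpace ℝ (Fin 3)
local notation "S2" => Metric.sphere (0 : EuclideanSpace ℝ (Fin 3)) 1
local notation "O3" => unitary (EuclideanSpace ℝ (Fin 3) →L[ℝ] EuclideanSpace ℝ (Fin 3))

attribute [local instance] continuousStar_clm compactSpace_unitary_clm

local notation "μO" => (MeasureTheory.Measure.haarMeasure (⊤ : PositiveCompacts O3))

attribute [local instance] isProbabilityMeasure_haarO3

/-! ### The zonal average: linear API, bounds, measurability -/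

/-- Homogeneity `Π₀(cψ) = c Π₀ψ` (no integrability needed). [folklore] -/
theorem zonalAvg_const_mul (c : ℝ) (ψ : E3 → ℝ) (v : E3) :
    zonalAvg (fun u => c * ψ u) v = c * zonalAvg ψ v := by
  unfold zonalAvg; rw [integral_const_mul]; ring

/-- Additivity `Π₀(ψ₁ + ψ₂) = Π₀ψ₁ + Π₀ψ₂` (both traces `σ`-integrable on the sphere `|u| = |v|`).
[folklore] -/
theorem zonalAvg_add {ψ₁ ψ₂ : E3 → ℝ} {v : E3}
    (h₁ : Integrable (fun ω : S2 => ψ₁ (‖v‖ • (ω : E3))) (sphereMeasure : Measure S2))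
    (h₂ : Integrable (fun ω : S2 => ψ₂ (‖v‖ • (ω : E3))) (sphereMeasure : Measure S2)) :
    zonalAvg (fun u => ψ₁ u + ψ₂ u) v = zonalAvg ψ₁ v + zonalAvg ψ₂ v := by
  unfold zonalAvg; rw [integral_add h₁ h₂]; ring

/-- `Π₀(ψ₁ - ψ₂) = Π₀ψ₁ - Π₀ψ₂` (both traces `σ`-integrable on the sphere `|u| = |v|`). [folklore] -/
theorem zonalAvg_sub {ψ₁ ψ₂ : E3 → ℝ} {v : E3}
    (h₁ : Integrable (fun ω : S2 => ψ₁ (‖v‖ • (ω : E3))) (sphereMeasure : Measure S2))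
    (h₂ : Integrable (fun ω : S2 => ψ₂ (‖v‖ • (ω : E3))) (sphereMeasure : Measure S2)) :
    zonalAvg (fun u => ψ₁ u - ψ₂ u) v = zonalAvg ψ₁ v - zonalAvg ψ₂ v := by
  unfold zonalAvg; rw [integral_sub h₁ h₂]; ring


/-- Idempotence `Π₀ Π₀ = Π₀` (the zonal average is constant on each sphere). [folklore] -/
theorem zonalAvg_zonalAvg (ψ : E3 → ℝ) (v : E3) : zonalAvg (zonalAvg ψ) v = zonalAvg ψ v :=
  (zonalAvg_congr (ψ₂ := fun _ => zonalAvg ψ v) fun ω => zonalAvg_eq_of_norm_eq ψ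
    (by rw [norm_smul, norm_norm, norm_eq_of_mem_sphere ω, mul_one])).trans (zonalAvg_const _ v)

/-- **Dipoles have no zonal part**: `Π₀(⟪Φ(|·|), ·⟫) = 0` (odd integrand on the sphere). [folklore] -/
theorem zonalAvg_dipole (Φ : ℝ → E3) (v : E3) : zonalAvg (fun u => ⟪Φ ‖u‖, u⟫_ℝ) v = 0 := by
  unfold zonalAvg
  rw [integral_sphere_eq_zero_of_odd, mul_zero]
  intro ω
  simp

/-- **Sup bound**: `|ψ| ≤ S` on the sphere `|u| = |v|` implies `|Π₀ψ(v)| ≤ S`. [folklore] -/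
theorem abs_zonalAvg_le {ψ : E3 → ℝ} {v : E3} {S : ℝ} (hS : ∀ ω : S2, |ψ (‖v‖ • (ω : E3))| ≤ S) :
    |zonalAvg ψ v| ≤ S := by
  haveI := isFiniteMeasure_sphereMeasure (E := E3)
  unfold zonalAvg
  have hint : ‖∫ ω : S2, ψ (‖v‖ • (ω : E3)) ∂(sphereMeasure : Measure S2)‖ ≤
      S * (sphereMeasure : Measure S2).real univ :=
    norm_integral_le_of_norm_le_const (Eventually.of_forall fun ω => by
      rw [Real.norm_eq_abs]; exact hS ω)
  rw [sphereMeasure_real_univ_fin3, Real.norm_eq_abs] at hint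
  rw [abs_mul, abs_of_pos (by positivity : (0 : ℝ) < (4 * π)⁻¹)]
  calc (4 * π)⁻¹ * |∫ ω : S2, ψ (‖v‖ • (ω : E3)) ∂(sphereMeasure : Measure S2)|
      ≤ (4 * π)⁻¹ * (S * (4 * π)) := mul_le_mul_of_nonneg_left hint (by positivity)
    _ = S := by field_simp


/-- Gaussian growth `|ψ| ≤ C e^{|·|²/4}` passes to the zonal average (the bound is radial).
[folklore] -/
theorem abs_zonalAvg_le_gauss {ψ : E3 → ℝ} {C : ℝ} (hC : ∀ x, |ψ x| ≤ C * Real.exp (‖x‖ ^ 2 / 4))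
    (v : E3) : |zonalAvg ψ v| ≤ C * Real.exp (‖v‖ ^ 2 / 4) :=
  abs_zonalAvg_le fun ω => by
    have := hC (‖v‖ • (ω : E3))
    rwa [norm_smul, norm_norm, norm_eq_of_mem_sphere ω, mul_one] at this

/-- The zonal average of a measurable function is measurable (Fubini measurability of a
parametric integral). [folklore] -/
theorem measurable_zonalAvg {ψ : E3 → ℝ} (hψ : Measurable ψ) : Measurable (zonalAvg ψ) := by
  have hm : Measurable fun p : E3 × S2 => ψ (‖p.1‖ • (p.2 : E3)) :=
    hψ.comp (by fun_prop : Continuous fun p : E3 × S2 => ‖p.1‖ • (p.2 : E3)).measurable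
  exact ((hm.stronglyMeasurable.integral_prod_right'
    (ν := (sphereMeasure : Measure S2))).measurable.const_mul _)

/-- Continuity of the zonal average of a continuous function. [folklore] -/
theorem continuous_zonalAvg {ψ : E3 → ℝ} (hψ : Continuous ψ) : Continuous (zonalAvg ψ) := by
  haveI := isFiniteMeasure_sphereMeasure (E := E3)
  have hc : Continuous (Function.uncurry fun (v : E3) (ω : S2) => ψ (‖v‖ • (ω : E3))) := by
    unfold Function.uncurry; fun_prop
  exact continuous_const.mul ((continuous_parametric_integral_of_continuous hc isCompact_univ).congr
    fun r => by rw [Measure.restrict_univ])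

/-- The trace `ω ↦ ψ(|v| ω)` of a measurable `ψ` of Gaussian growth is `σ`-integrable (measurable
and bounded by `C e^{|v|²/4}` on a finite measure). [folklore] -/
theorem integrable_sphere_trace_of_gaussGrowth {ψ : E3 → ℝ} (hψ : Measurable ψ) {C : ℝ}
    (hC : ∀ x, |ψ x| ≤ C * Real.exp (‖x‖ ^ 2 / 4)) (v : E3) :
    Integrable (fun ω : S2 => ψ (‖v‖ • (ω : E3))) (sphereMeasure : Measure S2) := by
  haveI := isFiniteMeasure_sphereMeasure (E := E3)
  refine (integrable_const (C * Real.exp (‖v‖ ^ 2 / 4))).mono'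
    (hψ.comp (by fun_prop : Continuous fun ω : S2 => ‖v‖ • (ω : E3)).measurable).aestronglyMeasurable
    (Eventually.of_forall fun ω => ?_)
  have := hC (‖v‖ • (ω : E3))
  rwa [norm_smul, norm_norm, norm_eq_of_mem_sphere ω, mul_one, ← Real.norm_eq_abs] at this

/-- `Π₀ (ψ - Π₀ψ) = 0`: the complementary projection `1 - Π₀` has no zonal part (`ψ` measurable of
Gaussian growth, so that both traces are integrable). [folklore] -/
theorem zonalAvg_sub_zonalAvg {ψ : E3 → ℝ} (hψ : Measurable ψ) {C : ℝ}
    (hC : ∀ x, |ψ x| ≤ C * Real.exp (‖x‖ ^ 2 / 4)) (v : E3) :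
    zonalAvg (fun u => ψ u - zonalAvg ψ u) v = 0 := by
  rw [zonalAvg_sub (integrable_sphere_trace_of_gaussGrowth hψ hC v)
    (integrable_sphere_trace_of_gaussGrowth (measurable_zonalAvg hψ) (abs_zonalAvg_le_gauss hC) v),
    zonalAvg_zonalAvg, sub_self]

/-! ### `L` is additive on the Gaussian-growth class; `L` commutes with `1 - Π₀` -/

/-- **`L(ψ₁ - ψ₂) = Lψ₁ - Lψ₂` at every velocity** for `ψ₁, ψ₂` measurable of Gaussian growth
(Grad's splitting converges absolutely on this class; `kernelAction_sub_of_gaussGrowth`).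
[folklore] -/
theorem hardSphereLinearizedOp_sub_of_gaussGrowth {ψ₁ ψ₂ : E3 → ℝ} (h₁ : Measurable ψ₁)
    (h₂ : Measurable ψ₂) {C₁ C₂ : ℝ} (hC₁ : ∀ x, |ψ₁ x| ≤ C₁ * Real.exp (‖x‖ ^ 2 / 4))
    (hC₂ : ∀ x, |ψ₂ x| ≤ C₂ * Real.exp (‖x‖ ^ 2 / 4)) (v : E3) :
    hardSphereLinearizedOp (fun x => ψ₁ x - ψ₂ x) v =
      hardSphereLinearizedOp ψ₁ v - hardSphereLinearizedOp ψ₂ v := by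
  have hC : ∀ x, |(ψ₁ - ψ₂) x| ≤ (C₁ + C₂) * Real.exp (‖x‖ ^ 2 / 4) := fun x => by
    rw [Pi.sub_apply, add_mul]
    exact (abs_sub _ _).trans (add_le_add (hC₁ x) (hC₂ x))
  have e1 := hardSphereLinearizedOp_eq_kernel_sub_of_gaussGrowth (show Measurable (ψ₁ - ψ₂) from h₁.sub h₂)
    hC v
  have e2 := hardSphereLinearizedOp_eq_kernel_sub_of_gaussGrowth h₁ hC₁ v
  have e3 := hardSphereLinearizedOp_eq_kernel_sub_of_gaussGrowth h₂ hC₂ v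
  have hsub := kernelAction_sub_of_gaussGrowth h₁ h₂ hC₁ hC₂ v
  change hardSphereLinearizedOp (ψ₁ - ψ₂) v = _
  rw [e1, hsub, e2, e3]
  simp only [Pi.sub_apply]
  ring

/-- **`L` commutes with the complementary projection `1 - Π₀`**:
`L(ψ - Π₀ψ)(v) = Lψ(v) - Π₀(Lψ)(v)` for `ψ` measurable of Gaussian growth. [folklore] -/
theorem hardSphereLinearizedOp_sub_zonalAvg {ψ : E3 → ℝ} (hψ : Measurable ψ) {C : ℝ}
    (hC : ∀ x, |ψ x| ≤ C * Real.exp (‖x‖ ^ 2 / 4)) (v : E3) :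
    hardSphereLinearizedOp (fun u => ψ u - zonalAvg ψ u) v =
      hardSphereLinearizedOp ψ v - zonalAvg (hardSphereLinearizedOp ψ) v := by
  rw [hardSphereLinearizedOp_sub_of_gaussGrowth hψ (measurable_zonalAvg hψ) hC (abs_zonalAvg_le_gauss hC),
    hardSphereLinearizedOp_zonalAvg hψ hC]

/-! ### Z4: `M`-orthogonality bookkeeping -/

/-- Odd integrands have zero Gaussian integral (the antipodal map preserves `M = stdGaussian`; no
integrability needed). [folklore] -/
theorem integral_stdGaussian_eq_zero_of_odd {F : E3 → ℝ} (hF : ∀ v, F (-v) = -F v) :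
    ∫ v, F v ∂stdGaussian E3 = 0 := by
  have h := (measurePreserving_linearIsometryEquiv_stdGaussian
    (LinearIsometryEquiv.neg ℝ (E := E3))).integral_comp
    (LinearIsometryEquiv.neg ℝ (E := E3)).toHomeomorph.measurableEmbedding F
  simp only [LinearIsometryEquiv.coe_neg, hF, integral_neg] at h
  linarith

/-- `⟪f, h⟫_M = 0` for `f` even and `h` odd (no integrability needed). [folklore] -/
theorem maxwellianInner_eq_zero_of_even_odd {f h : E3 → ℝ} (hf : ∀ v, f (-v) = f v)
    (hh : ∀ v, h (-v) = -h v) : maxwellianInner f h = 0 :=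
  integral_stdGaussian_eq_zero_of_odd fun v => by rw [hf, hh, mul_neg]

/-- **Z4a: the zonal average is `M`-orthogonal to the momentum invariants**, `⟪Π₀ψ, ⟪b, ·⟫⟫_M = 0`
(even times odd), for every `ψ`. [folklore] -/
theorem maxwellianInner_zonalAvg_inner (ψ : E3 → ℝ) (b : E3) :
    maxwellianInner (zonalAvg ψ) (fun v => ⟪b, v⟫_ℝ) = 0 :=
  maxwellianInner_eq_zero_of_even_odd (fun v => zonalAvg_eq_of_norm_eq ψ (norm_neg v))
    fun v => inner_neg_right b v

/-- `(1 + |w|)ᴺ e^{|w|²/4}` is integrable against the Maxwellian `M dw`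
(`M(w)(1+|w|)ᴺ e^{|w|²/4} = (2π)^{-3/2}(1+|w|)ᴺ e^{-|w|²/4}`; polynomial × Gaussian). [folklore] -/
theorem integrable_one_add_norm_pow_mul_exp_sq_div_four_stdGaussian (N : ℕ) :
    Integrable (fun w : E3 => (1 + ‖w‖) ^ N * Real.exp (‖w‖ ^ 2 / 4)) (stdGaussian E3) := by
  have hM : Measurable fun v : E3 => ENNReal.ofReal (globalMaxwellian v) :=
    continuous_globalMaxwellian.measurable.ennreal_ofReal
  rw [stdGaussian_eq_withDensity_globalMaxwellian_holds,
    integrable_withDensity_iff hM (Eventually.of_forall fun _ => ENNReal.ofReal_lt_top)]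
  have h := (PineauVicol2026.integrable_one_add_norm_pow_mul_exp_neg_mul_sq (E := E3) (c := 1 / 4)
    (by norm_num) N).const_mul ((2 * π) ^ (-(Module.finrank ℝ E3 : ℝ) / 2))
  refine h.congr (Eventually.of_forall fun w => ?_)
  simp only [globalMaxwellian]
  rw [ENNReal.toReal_ofReal (by positivity)]
  have hexp : Real.exp (‖w‖ ^ 2 / 4) * Real.exp (-‖w‖ ^ 2 / 2) = Real.exp (-(1 / 4) * ‖w‖ ^ 2) := by
    rw [← Real.exp_add]; congr 1; ring
  rw [show (1 + ‖w‖) ^ N * Real.exp (‖w‖ ^ 2 / 4) *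
      ((2 * π) ^ (-(Module.finrank ℝ E3 : ℝ) / 2) * Real.exp (-‖w‖ ^ 2 / 2)) =
      (2 * π) ^ (-(Module.finrank ℝ E3 : ℝ) / 2) *
        ((1 + ‖w‖) ^ N * (Real.exp (‖w‖ ^ 2 / 4) * Real.exp (-‖w‖ ^ 2 / 2))) by ring, hexp]

/-- Gaussian growth times polynomial growth is `M`-integrable. [folklore] -/
theorem integrable_mul_of_gaussGrowth_of_polyGrowth {f g : E3 → ℝ} (hf : Measurable f)
    (hg : Measurable g) {C D : ℝ} {N : ℕ} (hC : ∀ x, |f x| ≤ C * Real.exp (‖x‖ ^ 2 / 4))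
    (hD : ∀ x, |g x| ≤ D * (1 + ‖x‖) ^ N) : Integrable (fun v => f v * g v) (stdGaussian E3) := by
  refine ((integrable_one_add_norm_pow_mul_exp_sq_div_four_stdGaussian N).const_mul (C * D)).mono'
    (hf.mul hg).aestronglyMeasurable (Eventually.of_forall fun v => ?_)
  rw [Real.norm_eq_abs, abs_mul]
  calc |f v| * |g v| ≤ (C * Real.exp (‖v‖ ^ 2 / 4)) * (D * (1 + ‖v‖) ^ N) :=
        mul_le_mul (hC v) (hD v) (abs_nonneg _) ((abs_nonneg _).trans (hC v))
    _ = C * D * ((1 + ‖v‖) ^ N * Real.exp (‖v‖ ^ 2 / 4)) := by ring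

/-- **Z4b: the zonal average is `M`-symmetric against radial weights**: `⟪Π₀ψ, φ⟫_M = ⟪ψ, φ⟫_M`
for `ψ` measurable of Gaussian growth and `φ` radial, measurable, of polynomial growth (orbit
average, Fubini in `dM dR`, invariance of `M` and of `φ` under `R⁻¹`). In particular `Π₀`
preserves `⟪·, 1⟫_M` and `⟪·, |v|²⟫_M`. [folklore] -/
theorem maxwellianInner_zonalAvg_radial {ψ φ : E3 → ℝ} (hψ : Measurable ψ) {C : ℝ}
    (hC : ∀ x, |ψ x| ≤ C * Real.exp (‖x‖ ^ 2 / 4)) (hφm : Measurable φ)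
    (hφ : ∀ u u' : E3, ‖u‖ = ‖u'‖ → φ u = φ u') {D : ℝ} {N : ℕ} (hD : ∀ x, |φ x| ≤ D * (1 + ‖x‖) ^ N) :
    maxwellianInner (zonalAvg ψ) φ = maxwellianInner ψ φ := by
  have hint : Integrable (Function.uncurry fun (v : E3) (R : O3) => ψ (haarRot R v) * φ v)
      ((stdGaussian E3).prod μO) := by
    refine (((integrable_one_add_norm_pow_mul_exp_sq_div_four_stdGaussian N).const_mul (C * D)).comp_fst
      μO).mono' ((hψ.comp (continuous_haarRot_apply continuous_snd continuous_fst).measurable).mul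
        (hφm.comp measurable_fst)).aestronglyMeasurable (Eventually.of_forall fun p => ?_)
    rw [Function.uncurry_apply_pair, Real.norm_eq_abs, abs_mul]
    have h1 := hC (haarRot p.2 p.1)
    rw [LinearIsometryEquiv.norm_map] at h1
    calc |ψ (haarRot p.2 p.1)| * |φ p.1| ≤ (C * Real.exp (‖p.1‖ ^ 2 / 4)) * (D * (1 + ‖p.1‖) ^ N) :=
          mul_le_mul h1 (hD p.1) (abs_nonneg _) ((abs_nonneg _).trans h1)
      _ = C * D * ((1 + ‖p.1‖) ^ N * Real.exp (‖p.1‖ ^ 2 / 4)) := by ring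
  have hrot : ∀ R : O3, ∫ v, ψ (haarRot R v) * φ v ∂stdGaussian E3 = maxwellianInner ψ φ := by
    intro R
    rw [← maxwellianInner_comp_linearIsometryEquiv (haarRot R) ψ φ]
    unfold maxwellianInner
    refine integral_congr_ae (Eventually.of_forall fun v => ?_)
    simp only [Function.comp_apply]
    rw [hφ (haarRot R v) v (LinearIsometryEquiv.norm_map _ _)]
  unfold maxwellianInner
  simp_rw [zonalAvg_eq_integral_haar hψ hC, ← integral_mul_const]
  rw [integral_integral_swap hint]
  change ∫ R, ∫ v, ψ (haarRot R v) * φ v ∂stdGaussian E3 ∂μO = _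
  simp_rw [hrot]
  unfold maxwellianInner
  rw [integral_const, smul_eq_mul, probReal_univ, one_mul]

/-- **Registered helper `t12_zonalAvg_orthogonal_collisionInvariants`** (Z4 of the corrector plan):
the zonal average preserves `M`-orthogonality to the collision invariants `span{1, v, |v|²}` —
if `ψ ⊥_M` all invariants then so is `Π₀ψ` (it kills the momentum components by parity and is
`M`-symmetric against the radial ones `1, |v|²`). Hence the shift-free `ℓ = 0` sector of the
orthogonal pre-image stays orthogonal. (Stated with `zonalAvg` unfolded.) [folklore] -/
theorem t12_zonalAvg_orthogonal_collisionInvariants : ∀ (ψ : EuclideanSpace ℝ (Fin 3) → ℝ) (C : ℝ), Measurable ψ → (∀ x, |ψ x| ≤ C * Real.exp (‖x‖ ^ 2 / 4)) → (∀ φ ∈ Literature.Analysis.UnboundedOperators.collisionInvariants (EuclideanSpace ℝ (Fin 3)), Literature.Analysis.UnboundedOperators.maxwellianInner ψ φ = 0) → ∀ φ ∈ Literature.Analysis.UnboundedOperators.collisionInvariants (EuclideanSpace ℝ (Fin 3)), Literature.Analysis.UnboundedOperators.maxwellianInner (fun u : EuclideanSpace ℝ (Fin 3) => (4 * Real.pi)⁻¹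 * ∫ ω : Metric.sphere (0 : EuclideanSpace ℝ (Fin 3)) 1, ψ (‖u‖ • (ω : EuclideanSpace ℝ (Fin 3))) ∂Literature.MathematicalPhysics.KineticTheory.sphereMeasure) φ = 0 := by
  intro ψ C hψ hC horth φ hφ
  obtain ⟨a, c, b, rfl⟩ := mem_collisionInvariants_iff.1 hφ
  change maxwellianInner (zonalAvg ψ) _ = 0
  have hsplit : (fun v : E3 => a + ⟪b, v⟫_ℝ + c * ‖v‖ ^ 2) =
      (fun v : E3 => a + c * ‖v‖ ^ 2) + fun v : E3 => ⟪b, v⟫_ℝ := by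
    funext v; simp only [Pi.add_apply]; ring
  have hrad : ∀ x : E3, |a + c * ‖x‖ ^ 2| ≤ (|a| + |c|) * (1 + ‖x‖) ^ 2 := fun x => by
    refine (abs_add_le _ _).trans ?_
    rw [abs_mul, abs_of_nonneg (by positivity : (0 : ℝ) ≤ ‖x‖ ^ 2)]
    nlinarith [abs_nonneg a, abs_nonneg c, norm_nonneg x, mul_nonneg (abs_nonneg c) (norm_nonneg x)]
  have hlin : ∀ x : E3, |⟪b, x⟫_ℝ| ≤ ‖b‖ * (1 + ‖x‖) ^ 1 := fun x =>
    (abs_real_inner_le_norm b x).trans (by nlinarith [norm_nonneg b, norm_nonneg x])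
  have hZm := measurable_zonalAvg hψ
  have hZC := abs_zonalAvg_le_gauss hC
  rw [hsplit, maxwellianInner_add_right
      (integrable_mul_of_gaussGrowth_of_polyGrowth hZm (by fun_prop) hZC hrad)
      (integrable_mul_of_gaussGrowth_of_polyGrowth hZm (by fun_prop) hZC hlin),
    maxwellianInner_zonalAvg_inner, add_zero,
    maxwellianInner_zonalAvg_radial hψ hC (by fun_prop) (fun u u' h => by simp only [h]) hrad]
  exact horth _ (mem_collisionInvariants_iff.2 ⟨a, c, 0, by funext v; simp⟩)

/-- `zonalAvg` form of Z4. [folklore] -/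
theorem zonalAvg_orthogonal_collisionInvariants {ψ : E3 → ℝ} (hψ : Measurable ψ) {C : ℝ}
    (hC : ∀ x, |ψ x| ≤ C * Real.exp (‖x‖ ^ 2 / 4))
    (horth : ∀ φ ∈ collisionInvariants E3, maxwellianInner ψ φ = 0) :
    ∀ φ ∈ collisionInvariants E3, maxwellianInner (zonalAvg ψ) φ = 0 :=
  t12_zonalAvg_orthogonal_collisionInvariants ψ C hψ hC horth

end Summit.AtomisticToContinuum.HydrodynamicLimit.Theorems.ClampedCorrectorBirth
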